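import Summits.Ventures.LatticeQCDFlow.Scaling.LumpedCycleAnyCoupling
import Summits.Ventures.LatticeQCDFlow.Scaling.StarHubChainFirstOrder
import Summits.Ventures.LatticeQCDFlow.Scaling.FiniteOddsPersistenceForm
import Summits.Ventures.LatticeQCDFlow.Scaling.ResolventLaw

/-!
HONEST FRAMING: exact (Metropolis-corrected) sampling algorithms for lattice gauge theory; figures
of merit are autocorrelation/cost numbers at stated couplings and volumes; no continuum-physics
claim.

# FiniteOddsLumpedLaw — THE LAW OF THE LUMPED STAR AT SWAP ODDS `σ` MODULO THE PERSISTENCE INEQUALITY: WITH THE END-HUB LAWS DEFINED AS THE GEOMETRIC RESOLVENTS OF THE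
# ONE-COPY HUB CHAINS AND THE TAIL LAWS COUPLED BY ANY MONOTONE FAMILY `q̃`, IF EVERY EQUAL-HUB PAIR STATE SATISFIES
# `ρΔΦ ≤ σ·[G̃(Φ+e−2) + pΔ(2E_{μ_1}θ − E_ũX Wθ − E_ũY Wθ)]` THEN `d(n) ≤ ((K+1)(c+2K+2) + 2(K+1)(c+2K+6))·(1−ρ)ⁿ` (lean-2 GEN-36, ours)

Venture-side (OURS).  Cell `lqcd-flow` (pub-lqcd), unit `pub-lqcd-lean-2-g36`, 2026-08-29.  Chapter W (item 1 (i) at finite swap odds), file 7 = files 1–6 assembled on chapter V's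
cycle chain.  State space `X` in bijection with the lumped states `(z, N)` (`hinj`, `hsum`, `hsurj`, hub legal `hhub`); the one-copy hub chain of composition `N` is
`K_N(h,v) = (N_v/K)acc(h,v)` (`v ≠ h`, rows of absent contents = identity; `Scaling/StarHubChainFirstOrder`); the END-HUB LAW of state `x` IS the geometric resolvent
`u_x = (1−σ)δ_(hub x) + σ·u_xK_(comp x)` (`Scaling/ResolventLaw`; `0 ≤ σ < 1`), its tail law `ũ_x = u_xK`; the cycle chain `P` of chapter V file 9 is built from these `u_x`; the
two copies are coupled by `q_{xy} = (1−σ)δ_(hub x, hub y) + σ·q̃_{xy}` with `q̃_{xy}` ANY coupling of `(ũ_x, ũ_y)` that is monotone on equal-hub pairs (the numerics of this generation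
found the optimal one monotone in every state); potential `Ψ_σ(x,y) = Δ·(c − (1−σ)(θ_(hub x) + θ_(hub y)) + Σ_v θ_v(comp x + comp y)(v)) + C·𝟙{hub x ≠ hub y}`, `θ = 1/(1+pW)`, ANY constant `c ≥ 1` (chapter V
used `c = 2`; `c = 2K+2` is the constant of `Scaling/OneAttemptCertificate` and of the all-odds conjecture of MEMO-gen36, see `Scaling/FiniteOddsPersistenceForm`).
RESULT (`finiteOdds_lumped_worstTvDist_le`): if on every equal-hub pair the PERSISTENCE INEQUALITY of `Scaling/FiniteOddsPersistenceForm` holds with rate `ρ ≤ ½`, then for every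
stationary law `π` of `P`: **`d(n) ≤ ((K+1)(c+2K+2) + 2(K+1)(c+2K+6))·(1−ρ)ⁿ`** (so `t_mix(ε) ≤ ⌈ρ⁻¹·log(((K+1)(c+2K+2) + 2(K+1)(c+2K+6))/ε)⌉₊` by the tree's `mixingTime_le`, not restated).
Everything structural is discharged here (legality and normalisation of the resolvent end-hub laws, the mixture coupling for equal and unequal hubs, the bounds `c ≤ Φ ≤ c+2K+2`, the
crude bound on unequal-hub pairs, the insertion term `e = 2(1−σ)θ_z + 2σθ̄`); what is taken as a hypothesis is exactly the inequality of MEMO-gen36 §3.  Hypothesis-equations, no definitions.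

## What is proved

* §1 `mixture2_isCoupling` (two hub contents), `finiteOdds_endHub_nonneg` ∕ `_sum` ∕ `_legal`, `finiteOdds_tail_sum`, `finiteOdds_e_eq`, `finiteOdds_F_ge`, `finiteOdds_F_le`,
  `finiteOdds_survivors_le`, `finiteOdds_functional_le`.
* §2 **`finiteOdds_lumped_worstTvDist_le`** (any constant `c ≥ 1`), `finiteOdds_lumped_worstTvDist_le_twoK` (`c = 2K+2`).

Reading (no numerics implied): the conditional law of item 1 (i) for the lumped star at any swap odds; the condition is one inequality per equal-hub pair state about two one-copy
resolvents and one coupling of them, for which `Scaling/ResolventPairCoupling` provides the method (one sub-solution on hub pairs).  NOT CLAIMED: the inequality; anything about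
the step chain (the cycle chain is the object, as in chapter V).  Literature grade (cell rule): OWN, elementary on the tree; nothing cited as a fact; no new bib keys.
-/

open Finset Matrix
open Literature.Probability.MarkovChains

namespace Summit.Ventures.LatticeQCDFlow.Scaling

section FiniteOddsLumped
variable {X : Type*} [Fintype X] [DecidableEq X] {S : Type*} [Fintype S] [DecidableEq S]
variable {hub : X → S} {comp : X → S → ℕ} {K : ℕ} {μ0 W θ : S → ℝ} {p σ ρ C c : ℝ} {acc : S → S → ℝ} {Kh : (S → ℕ) → S → S → ℝ}
variable {u ut : X → S → ℝ} {qt q : X → X → S → S → ℝ}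
variable {P : X → X → ℝ} {Q : Matrix (X × X) (X × X) ℝ} {Δ : (S → ℕ) → (S → ℕ) → ℕ} {F Ψ : X × X → ℝ}

/-! ## §1 Structural facts -/

omit [Fintype X] [DecidableEq X] in
/-- **The mixture with two hub contents couples the two end-hub laws:** `q = (1−σ)δ_(zx,zy) + σq̃` couples `(1−σ)δ_zx + σũ_X` with `(1−σ)δ_zy + σũ_Y` (`0 ≤ σ ≤ 1`). [ours] -/
theorem mixture2_isCoupling {zx zy : S} {utX utY uX uY : S → ℝ} {qt' q' : S → S → ℝ} (hσ0 : 0 ≤ σ) (hσ1 : σ ≤ 1) (hqt : IsCoupling utX utY qt')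
    (huX : ∀ a, uX a = (1 - σ) * (if a = zx then (1 : ℝ) else 0) + σ * utX a)
    (huY : ∀ b, uY b = (1 - σ) * (if b = zy then (1 : ℝ) else 0) + σ * utY b)
    (hq : ∀ a b, q' a b = (1 - σ) * ((if a = zx then (1 : ℝ) else 0) * (if b = zy then (1 : ℝ) else 0)) + σ * qt' a b) :
    IsCoupling uX uY q' := by
  classical
  refine ⟨fun a b => ?_, fun a => ?_, fun b => ?_⟩
  · rw [hq]
    exact add_nonneg (mul_nonneg (by linarith) (mul_nonneg (by split_ifs <;> norm_num) (by split_ifs <;> norm_num))) (mul_nonneg hσ0 (hqt.1 a b))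
  · simp_rw [hq]
    rw [sum_add_distrib, ← mul_sum, ← mul_sum, ← mul_sum, hqt.2.1 a, huX a]
    simp
  · simp_rw [hq]
    rw [sum_add_distrib, ← mul_sum, ← mul_sum, hqt.2.2 b, huY b]
    congr 1
    rw [show (∑ a, (if a = zx then (1 : ℝ) else 0) * (if b = zy then (1 : ℝ) else 0)) = (∑ a, (if a = zx then (1 : ℝ) else 0)) * (if b = zy then (1 : ℝ) else 0) by
      rw [sum_mul]]
    simp

omit [Fintype X] [DecidableEq X] in
/-- **The resolvent end-hub laws are probability vectors** (`Scaling/ResolventLaw` on the star's hub chain of `Scaling/StarHubChainFirstOrder`). [ours] -/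
theorem finiteOdds_endHub_nonneg (hW : ∀ v, 0 < W v) (hacc : ∀ h v, acc h v = min 1 (W h / W v))
    (hKoff : ∀ N h v, h ≠ v → Kh N h v = if N h = 0 then 0 else (N v : ℝ) / K * acc h v) (hKdiag : ∀ N h, Kh N h h = 1 - ∑ v ∈ univ.erase h, Kh N h v)
    (hK : 1 ≤ K) (hsum : ∀ x, ∑ v, comp x v = K + 1) (hσ0 : 0 ≤ σ) (hσ1 : σ < 1)
    (hu : ∀ x v, u x v = (1 - σ) * (if v = hub x then (1 : ℝ) else 0) + σ * ∑ h, u x h * Kh (comp x) h v) (x : X) (v : S) : 0 ≤ u x v :=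
  geomResolvent_nonneg (starHub_nonneg hW hacc (hKoff (comp x)) (hKdiag (comp x)) hK (hsum x)) (starHub_rowsum (hKdiag (comp x))) hσ0 hσ1
    (fun w => by split_ifs <;> norm_num) (hu x) v

omit [Fintype X] [DecidableEq X] in
/-- The resolvent end-hub laws have total mass one. [ours] -/
theorem finiteOdds_endHub_sum (hKdiag : ∀ N h, Kh N h h = 1 - ∑ v ∈ univ.erase h, Kh N h v) (hσ1 : σ < 1)
    (hu : ∀ x v, u x v = (1 - σ) * (if v = hub x then (1 : ℝ) else 0) + σ * ∑ h, u x h * Kh (comp x) h v) (x : X) : ∑ v, u x v = 1 := by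
  rw [geomResolvent_sum (starHub_rowsum (hKdiag (comp x))) (ne_of_lt hσ1) (hu x)]
  simp

omit [Fintype X] [DecidableEq X] in
/-- **Legality:** the resolvent end-hub law only charges contents present in the composition (`hub x` is present). [ours] -/
theorem finiteOdds_endHub_legal (hW : ∀ v, 0 < W v) (hacc : ∀ h v, acc h v = min 1 (W h / W v))
    (hKoff : ∀ N h v, h ≠ v → Kh N h v = if N h = 0 then 0 else (N v : ℝ) / K * acc h v) (hKdiag : ∀ N h, Kh N h h = 1 - ∑ v ∈ univ.erase h, Kh N h v)
    (hK : 1 ≤ K) (hsum : ∀ x, ∑ v, comp x v = K + 1) (hhub : ∀ x, comp x (hub x) ≠ 0) (hσ0 : 0 ≤ σ) (hσ1 : σ < 1)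
    (hu : ∀ x v, u x v = (1 - σ) * (if v = hub x then (1 : ℝ) else 0) + σ * ∑ h, u x h * Kh (comp x) h v) (x : X) (a : S) (ha : u x a ≠ 0) :
    comp x a ≠ 0 := by
  by_contra h0
  refine ha (geomResolvent_support_subset (starHub_nonneg hW hacc (hKoff (comp x)) (hKdiag (comp x)) hK (hsum x)) (starHub_rowsum (hKdiag (comp x))) hσ0 hσ1
    (hu x) (fun v => comp x v ≠ 0) (fun v hv => ?_) (fun h v hh hv => ?_) a (by simpa using h0))
  · have : v ≠ hub x := fun e => hv (e ▸ hhub x)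
    simp [this]
  · exact starHub_closed (hKoff (comp x)) hh (by simpa using hv)

omit [Fintype X] [DecidableEq X] in
/-- The tail laws have total mass one. [ours] -/
theorem finiteOdds_tail_sum (hKdiag : ∀ N h, Kh N h h = 1 - ∑ v ∈ univ.erase h, Kh N h v) (hσ1 : σ < 1)
    (hu : ∀ x v, u x v = (1 - σ) * (if v = hub x then (1 : ℝ) else 0) + σ * ∑ h, u x h * Kh (comp x) h v)
    (hut : ∀ x v, ut x v = ∑ h, u x h * Kh (comp x) h v) (x : X) : ∑ v, ut x v = 1 := by
  rw [geomResolvent_tail_sum (u := u x) (starHub_rowsum (hKdiag (comp x))) (hut x), finiteOdds_endHub_sum hKdiag hσ1 hu x]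

omit [Fintype X] [DecidableEq X] [DecidableEq S] in
/-- **The insertion term on an equal-hub pair:** with `s = −(1−σ)θ`, `2Σμ_0 s − s(z) − s(z) + 2Σμ_0θ = 2(1−σ)θ_z + 2σ·Σμ_0θ`. [ours] -/
theorem finiteOdds_e_eq (z : S) :
    2 * ∑ v, μ0 v * (-(1 - σ) * θ v) - (-(1 - σ) * θ z) - (-(1 - σ) * θ z) + 2 * ∑ v, μ0 v * θ v
      = 2 * (1 - σ) * θ z + 2 * σ * ∑ v, μ0 v * θ v := by
  have : ∑ v, μ0 v * (-(1 - σ) * θ v) = -(1 - σ) * ∑ v, μ0 v * θ v := by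
    rw [mul_sum]; exact sum_congr rfl fun v _ => by ring
  rw [this]; ring

omit [Fintype X] [DecidableEq X] [DecidableEq S] in
/-- `Φ ≥ c` on every pair (`θ ∈ [½,1]`, hubs present, `σ ≥ 0`). [ours] -/
theorem finiteOdds_F_ge (hW : ∀ v, 0 < W v) (hp0 : 0 ≤ p) (hp : ∀ v, p * W v ≤ 1) (hθ : ∀ v, θ v = 1 / (1 + p * W v)) (hσ0 : 0 ≤ σ)
    (hhub : ∀ x, comp x (hub x) ≠ 0)
    (hF : ∀ x y, F (x, y) = c + (-(1 - σ) * θ (hub x)) + (-(1 - σ) * θ (hub y)) + ∑ v, θ v * ((comp x v : ℝ) + (comp y v : ℝ))) (x y : X) :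
    c ≤ F (x, y) := by
  rw [hF]
  have hθ0 : ∀ v, 0 ≤ θ v := fun v => by have := (theta_mem hW hp0 hp hθ v).1; linarith
  -- the mass contains the two hub particles
  have hmx : θ (hub x) ≤ ∑ v, θ v * (comp x v : ℝ) := by
    have h1 : (1 : ℝ) ≤ comp x (hub x) := by exact_mod_cast Nat.one_le_iff_ne_zero.mpr (hhub x)
    calc θ (hub x) ≤ θ (hub x) * (comp x (hub x) : ℝ) := le_mul_of_one_le_right (hθ0 _) h1
      _ ≤ ∑ v, θ v * (comp x v : ℝ) := single_le_sum (f := fun v => θ v * (comp x v : ℝ)) (fun v _ => mul_nonneg (hθ0 v) (Nat.cast_nonneg _)) (mem_univ _)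
  have hmy : θ (hub y) ≤ ∑ v, θ v * (comp y v : ℝ) := by
    have h1 : (1 : ℝ) ≤ comp y (hub y) := by exact_mod_cast Nat.one_le_iff_ne_zero.mpr (hhub y)
    calc θ (hub y) ≤ θ (hub y) * (comp y (hub y) : ℝ) := le_mul_of_one_le_right (hθ0 _) h1
      _ ≤ ∑ v, θ v * (comp y v : ℝ) := single_le_sum (f := fun v => θ v * (comp y v : ℝ)) (fun v _ => mul_nonneg (hθ0 v) (Nat.cast_nonneg _)) (mem_univ _)
  have hsplit : ∑ v, θ v * ((comp x v : ℝ) + (comp y v : ℝ)) = ∑ v, θ v * (comp x v : ℝ) + ∑ v, θ v * (comp y v : ℝ) := by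
    rw [← sum_add_distrib]; exact sum_congr rfl fun v _ => by ring
  rw [hsplit]
  nlinarith [hθ0 (hub x), hθ0 (hub y), mul_nonneg hσ0 (hθ0 (hub x)), mul_nonneg hσ0 (hθ0 (hub y))]

omit [Fintype X] [DecidableEq X] [DecidableEq S] in
/-- `Φ ≤ c + 2K + 2` on every pair. [ours] -/
theorem finiteOdds_F_le (hW : ∀ v, 0 < W v) (hp0 : 0 ≤ p) (hp : ∀ v, p * W v ≤ 1) (hθ : ∀ v, θ v = 1 / (1 + p * W v)) (hσ1 : σ < 1)
    (hsum : ∀ x, ∑ v, comp x v = K + 1)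
    (hF : ∀ x y, F (x, y) = c + (-(1 - σ) * θ (hub x)) + (-(1 - σ) * θ (hub y)) + ∑ v, θ v * ((comp x v : ℝ) + (comp y v : ℝ))) (x y : X) :
    F (x, y) ≤ c + 2 * K + 2 := by
  rw [hF]
  have hθ0 : ∀ v, 0 ≤ θ v := fun v => by have := (theta_mem hW hp0 hp hθ v).1; linarith
  have hm := (theta_mass_le hW hp0 hp hθ (comp x + comp y)).2
  have hcast : ∀ v, ((comp x + comp y) v : ℝ) = (comp x v : ℝ) + (comp y v : ℝ) := fun v => by push_cast [Pi.add_apply]; ring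
  simp_rw [hcast] at hm
  have htot : ∑ v, ((comp x v : ℝ) + (comp y v : ℝ)) = 2 * K + 2 := by
    rw [sum_add_distrib, ← Nat.cast_sum, ← Nat.cast_sum, hsum x, hsum y]; push_cast; ring
  rw [htot] at hm
  nlinarith [hθ0 (hub x), hθ0 (hub y)]

omit [Fintype X] [DecidableEq X] in
/-- Survivors have distance at most `K + 1`. [ours] -/
theorem finiteOdds_survivors_le (hΔ : ∀ N N', Δ N N' = ∑ v, (N v - N' v)) (hsum : ∀ x, ∑ v, comp x v = K + 1) (x y : X) (a b : S) :
    (Δ (comp x - Pi.single a 1) (comp y - Pi.single b 1) : ℝ) ≤ K + 1 := by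
  have h1 := cdist_le_sum hΔ (comp x - Pi.single a 1) (comp y - Pi.single b 1)
  have h2 : ∑ v, (comp x - Pi.single a 1 : S → ℕ) v ≤ ∑ v, comp x v := sum_le_sum fun v _ => by
    simp only [Pi.sub_apply]; exact Nat.sub_le _ _
  rw [hsum x] at h2
  exact_mod_cast h1.trans h2

omit [Fintype X] [DecidableEq X] in
/-- **Crude bound on every pair:** the one-step functional is at most `(K+1)(c+2K+6)` (`c ≥ 0`). [ours] -/
theorem finiteOdds_functional_le (hW : ∀ v, 0 < W v) (hp0 : 0 ≤ p) (hp : ∀ v, p * W v ≤ 1) (hθ : ∀ v, θ v = 1 / (1 + p * W v)) (hc0 : 0 ≤ c) (hσ0 : 0 ≤ σ) (hσ1 : σ < 1)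
    (hμ0 : ∀ v, 0 ≤ μ0 v) (hμ1 : ∑ v, μ0 v = 1) (hΔ : ∀ N N', Δ N N' = ∑ v, (N v - N' v)) (hsum : ∀ x, ∑ v, comp x v = K + 1)
    (hqc : ∀ x y, IsCoupling (u x) (u y) (q x y)) (hu1 : ∀ x, ∑ v, u x v = 1)
    (hF : ∀ x y, F (x, y) = c + (-(1 - σ) * θ (hub x)) + (-(1 - σ) * θ (hub y)) + ∑ v, θ v * ((comp x v : ℝ) + (comp y v : ℝ))) (x y : X) :
    ∑ a, ∑ b, q x y a b * ((Δ (comp x - Pi.single a 1) (comp y - Pi.single b 1) : ℝ)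
        * (F (x, y) + (2 * ∑ v, μ0 v * (-(1 - σ) * θ v) - (-(1 - σ) * θ (hub x)) - (-(1 - σ) * θ (hub y)) + 2 * ∑ v, μ0 v * θ v) - θ a - θ b))
      ≤ (K + 1) * (c + 2 * K + 6) := by
  have hθm := theta_mem hW hp0 hp hθ
  have hθbar1 : ∑ v, μ0 v * θ v ≤ 1 := by
    calc ∑ v, μ0 v * θ v ≤ ∑ v, μ0 v := sum_le_sum fun v _ => mul_le_of_le_one_right (hμ0 v) (hθm v).2
      _ = 1 := hμ1
  have hθbar0 : 0 ≤ ∑ v, μ0 v * θ v := sum_nonneg fun v _ => mul_nonneg (hμ0 v) (by linarith [(hθm v).1])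
  have hs : ∑ v, μ0 v * (-(1 - σ) * θ v) = -(1 - σ) * ∑ v, μ0 v * θ v := by rw [mul_sum]; exact sum_congr rfl fun v _ => by ring
  have hFle := finiteOdds_F_le hW hp0 hp hθ hσ1 hsum hF x y
  -- each term is at most `(K+1)(2K+8)`
  have hterm : ∀ a b, ((Δ (comp x - Pi.single a 1) (comp y - Pi.single b 1) : ℝ)
        * (F (x, y) + (2 * ∑ v, μ0 v * (-(1 - σ) * θ v) - (-(1 - σ) * θ (hub x)) - (-(1 - σ) * θ (hub y)) + 2 * ∑ v, μ0 v * θ v) - θ a - θ b))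
      ≤ (K + 1) * (c + 2 * K + 6) := by
    intro a b
    have hD := finiteOdds_survivors_le hΔ hsum x y a b
    have hD0 : (0 : ℝ) ≤ Δ (comp x - Pi.single a 1) (comp y - Pi.single b 1) := Nat.cast_nonneg _
    set fac : ℝ := F (x, y) + (2 * ∑ v, μ0 v * (-(1 - σ) * θ v) - (-(1 - σ) * θ (hub x)) - (-(1 - σ) * θ (hub y)) + 2 * ∑ v, μ0 v * θ v) - θ a - θ b
      with hfacdef
    have hfac : fac ≤ c + 2 * K + 6 := by
      rw [hfacdef, hs]
      nlinarith [(hθm a).1, (hθm b).1, (hθm (hub x)).2, (hθm (hub y)).2, mul_nonneg (sub_nonneg.mpr hσ1.le) hθbar0]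
    have hK0 : (0 : ℝ) ≤ (K + 1) * (c + 2 * K + 6) := by positivity
    by_cases hf : 0 ≤ fac
    · exact mul_le_mul hD hfac hf (by positivity)
    · have hneg : (Δ (comp x - Pi.single a 1) (comp y - Pi.single b 1) : ℝ) * fac ≤ 0 :=
        mul_nonpos_of_nonneg_of_nonpos hD0 (le_of_lt (not_le.mp hf))
      linarith
  calc _ ≤ ∑ a, ∑ b, q x y a b * ((K + 1) * (c + 2 * K + 6)) :=
        sum_le_sum fun a _ => sum_le_sum fun b _ => mul_le_mul_of_nonneg_left (hterm a b) ((hqc x y).1 a b)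
    _ = (∑ a, ∑ b, q x y a b) * ((K + 1) * (c + 2 * K + 6)) := by
        rw [sum_mul]; exact sum_congr rfl fun a _ => by rw [sum_mul]
    _ = (K + 1) * (c + 2 * K + 6) := by
        have : ∑ a, ∑ b, q x y a b = 1 := by
          rw [show (∑ a, ∑ b, q x y a b) = ∑ a, u x a from sum_congr rfl fun a _ => (hqc x y).2.1 a, hu1 x]
        rw [this, one_mul]

/-! ## §2 The conditional law -/

/-- **THE LAW OF THE LUMPED STAR AT SWAP ODDS `σ` MODULO THE PERSISTENCE INEQUALITY.**  End-hub laws = geometric resolvents of the one-copy hub chains; tail laws coupled by any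
family `q̃` that is monotone on equal-hub pairs; `0 ≤ σ < 1`, `0 ≤ ρ ≤ ½`; if for every pair with `hub x = hub y = z`
`ρ·Δ·Φ ≤ σ·[(Δ − E_q̃Δ')·(Φ + e − 2) + p·Δ·(2Σμ_0Wθ − Σ ũ_x Wθ − Σ ũ_y Wθ)]` (`Φ = F(x,y)`, `e = 2(1−σ)θ_z + 2σθ̄`), then
`d(n) ≤ ((K+1)(c+2K+2) + 2(K+1)(c+2K+6))·(1−ρ)ⁿ` for every stationary `π` of the cycle chain (`c ≥ 1`). [ours] -/
theorem finiteOdds_lumped_worstTvDist_le [Nonempty X] (hinj : ∀ x x', hub x = hub x' → comp x = comp x' → x = x') (hsum : ∀ x, ∑ v, comp x v = K + 1)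
    (hsurj : ∀ (z : S) (N : S → ℕ), ∑ v, N v = K + 1 → N z ≠ 0 → ∃ x, hub x = z ∧ comp x = N) (hhub : ∀ x, comp x (hub x) ≠ 0) (hK : 1 ≤ K)
    (hW : ∀ v, 0 < W v) (hp0 : 0 ≤ p) (hp : ∀ v, p * W v ≤ 1) (hθ : ∀ v, θ v = 1 / (1 + p * W v)) (hacc : ∀ h v, acc h v = min 1 (W h / W v))
    (hμ0 : ∀ v, 0 ≤ μ0 v) (hμ1 : ∑ v, μ0 v = 1) (hc1 : 1 ≤ c) (hσ0 : 0 ≤ σ) (hσ1 : σ < 1) (hρ0 : 0 ≤ ρ) (hρ : ρ ≤ 1 / 2)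
    (hKoff : ∀ N h v, h ≠ v → Kh N h v = if N h = 0 then 0 else (N v : ℝ) / K * acc h v) (hKdiag : ∀ N h, Kh N h h = 1 - ∑ v ∈ univ.erase h, Kh N h v)
    (hu : ∀ x v, u x v = (1 - σ) * (if v = hub x then (1 : ℝ) else 0) + σ * ∑ h, u x h * Kh (comp x) h v)
    (hut : ∀ x v, ut x v = ∑ h, u x h * Kh (comp x) h v)
    (hqtc : ∀ x y, IsCoupling (ut x) (ut y) (qt x y))
    (hq : ∀ x y a b, q x y a b = (1 - σ) * ((if a = hub x then (1 : ℝ) else 0) * (if b = hub y then (1 : ℝ) else 0)) + σ * qt x y a b)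
    (hΔ : ∀ N N', Δ N N' = ∑ v, (N v - N' v))
    (hmono : ∀ x y, hub x = hub y → ∀ a b, qt x y a b ≠ 0 → Δ (comp x - Pi.single a 1) (comp y - Pi.single b 1) ≤ Δ (comp x) (comp y))
    (hP : ∀ x x', P x x' = ∑ a, u x a * (μ0 (hub x') * (if comp x' + Pi.single a 1 = comp x + Pi.single (hub x') 1 then (1 : ℝ) else 0)))
    (hQ : ∀ x y x' y', Q (x, y) (x', y') = ∑ a, ∑ b, q x y a b * (μ0 (hub x')
      * (if comp x' + Pi.single a 1 = comp x + Pi.single (hub x') 1 then (1 : ℝ) else 0))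
      * ((if hub y' = hub x' then (1 : ℝ) else 0) * (if comp y' + Pi.single b 1 = comp y + Pi.single (hub y') 1 then (1 : ℝ) else 0)))
    (hF : ∀ x y, F (x, y) = c + (-(1 - σ) * θ (hub x)) + (-(1 - σ) * θ (hub y)) + ∑ v, θ v * ((comp x v : ℝ) + (comp y v : ℝ)))
    (hC : C = 2 * ((K + 1) * (c + 2 * K + 6)))
    (hΨ : ∀ x y, Ψ (x, y) = (Δ (comp x) (comp y) : ℝ) * F (x, y) + C * (if hub x = hub y then (0 : ℝ) else 1))
    (hpers : ∀ x y, hub x = hub y →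
      ρ * (Δ (comp x) (comp y) : ℝ) * F (x, y)
        ≤ σ * (((Δ (comp x) (comp y) : ℝ) - ∑ a, ∑ b, qt x y a b * (Δ (comp x - Pi.single a 1) (comp y - Pi.single b 1) : ℝ))
              * (F (x, y) + (2 * (1 - σ) * θ (hub x) + 2 * σ * ∑ v, μ0 v * θ v) - 2)
            + p * (Δ (comp x) (comp y) : ℝ) * (2 * ∑ v, μ0 v * (W v * θ v) - ∑ a, ut x a * (W a * θ a) - ∑ b, ut y b * (W b * θ b))))
    {π : X → ℝ} (hπ : IsStationary π P) (hπ0 : ∀ x, 0 ≤ π x) (hπ1 : ∑ x, π x = 1) (n : ℕ) :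
    worstTvDist P π n ≤ ((K + 1) * (c + 2 * K + 2) + 2 * ((K + 1) * (c + 2 * K + 6))) * (1 - ρ) ^ n := by
  -- the end-hub laws
  have hu0 : ∀ x a, 0 ≤ u x a := finiteOdds_endHub_nonneg hW hacc hKoff hKdiag hK hsum hσ0 hσ1 hu
  have hu1 : ∀ x, ∑ a, u x a = 1 := finiteOdds_endHub_sum hKdiag hσ1 hu
  have hlegal : ∀ x a, u x a ≠ 0 → comp x a ≠ 0 := finiteOdds_endHub_legal hW hacc hKoff hKdiag hK hsum hhub hσ0 hσ1 hu
  have hut1 : ∀ x, ∑ v, ut x v = 1 := finiteOdds_tail_sum hKdiag hσ1 hu hut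
  have hdec : ∀ x v, u x v = (1 - σ) * (if v = hub x then (1 : ℝ) else 0) + σ * ut x v := fun x v => geomResolvent_decomp (hu x) (hut x) v
  have hqc : ∀ x y, IsCoupling (u x) (u y) (q x y) := fun x y =>
    mixture2_isCoupling hσ0 hσ1.le (hqtc x y) (hdec x) (hdec y) (hq x y)
  -- bounds on `F`
  have hF1 : ∀ x y, 1 ≤ F (x, y) := fun x y => by linarith [finiteOdds_F_ge hW hp0 hp hθ hσ0 hhub hF x y]
  have hFmax : ∀ x y, F (x, y) ≤ c + 2 * K + 2 := finiteOdds_F_le hW hp0 hp hθ hσ1 hsum hF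
  have hK0 : (0 : ℝ) ≤ K := Nat.cast_nonneg _
  have hC1 : 1 ≤ C := by rw [hC]; nlinarith
  have hc0 : 0 ≤ c := by linarith
  have hBC : ((K : ℝ) + 1) * (c + 2 * K + 6) ≤ (1 - ρ) * C := by rw [hC]; nlinarith
  have hcrit : ∀ x y, hub x = hub y → ∑ a, ∑ b, q x y a b * ((Δ (comp x - Pi.single a 1) (comp y - Pi.single b 1) : ℝ)
        * (F (x, y) + (2 * ∑ v, μ0 v * (-(1 - σ) * θ v) - (-(1 - σ) * θ (hub x)) - (-(1 - σ) * θ (hub y)) + 2 * ∑ v, μ0 v * θ v) - θ a - θ b))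
        ≤ (1 - ρ) * ((Δ (comp x) (comp y) : ℝ) * F (x, y)) := by
    intro x y hxy
    -- the equal-hub criterion from the persistence inequality
    rw [hxy, finiteOdds_e_eq]
    have hz : comp x (hub y) ≠ 0 := hxy ▸ hhub x
    have hDz : (Δ (comp x - Pi.single (hub y) 1) (comp y - Pi.single (hub y) 1) : ℝ) = (Δ (comp x) (comp y) : ℝ) := by
      have ex := urnChain_survivor (comp x) hz
      have ey := urnChain_survivor (comp y) (hhub y)
      have h := cdist_add_single_same hΔ (comp x - Pi.single (hub y) 1) (comp y - Pi.single (hub y) 1) (hub y)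
      rw [← ex, ← ey] at h
      exact_mod_cast h.symm
    have h := finiteOdds_persistence_contract (z := hub y) (utX := ut x) (utY := ut y) (qt := qt x y) (q := q x y)
      (Dn := fun a b => (Δ (comp x - Pi.single a 1) (comp y - Pi.single b 1) : ℝ)) (D := (Δ (comp x) (comp y) : ℝ)) (Φ := F (x, y))
      (e := 2 * (1 - σ) * θ (hub y) + 2 * σ * ∑ v, μ0 v * θ v) (ρ := ρ)
      hW hp0 hp hθ hμ1 hσ0 (hqtc x y) (hut1 x) (hut1 y) (fun a b => by rw [hq x y a b, hxy]) hDz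
      (fun a b hab => by exact_mod_cast hmono x y hxy a b hab) rfl (by have := hpers x y hxy; rw [hxy] at this; exact this)
    calc _ = ∑ a, ∑ b, q x y a b * ((Δ (comp x - Pi.single a 1) (comp y - Pi.single b 1) : ℝ)
            * (F (x, y) + (2 * (1 - σ) * θ (hub y) + 2 * σ * ∑ v, μ0 v * θ v) - θ a - θ b)) := rfl
      _ ≤ (1 - ρ) * (Δ (comp x) (comp y) : ℝ) * F (x, y) := h
      _ = (1 - ρ) * ((Δ (comp x) (comp y) : ℝ) * F (x, y)) := by ring

  have h := lumpedAny_worstTvDist_le (c := c) (s := fun v => -(1 - σ) * θ v) (r := θ) (C := C) (Fmax := c + 2 * K + 2) hinj hsum hsurj hμ0 hμ1 hlegal hqc hΔ hP hQ hF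
    hΨ hF1 hFmax hC1 (by linarith) hBC (finiteOdds_functional_le hW hp0 hp hθ hc0 hσ0 hσ1 hμ0 hμ1 hΔ hsum hqc hu1 hF) hcrit hπ hπ0 hπ1 n
  rw [hC] at h
  exact h

/-- **The same with the constant `c = 2K+2`** (the constant of `Scaling/OneAttemptCertificate` and of MEMO-gen36's all-odds conjecture): `d(n) ≤ ((K+1)(4K+4) + 2(K+1)(4K+8))·(1−ρ)ⁿ`. [ours] -/
theorem finiteOdds_lumped_worstTvDist_le_twoK [Nonempty X] (hinj : ∀ x x', hub x = hub x' → comp x = comp x' → x = x') (hsum : ∀ x, ∑ v, comp x v = K + 1)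
    (hsurj : ∀ (z : S) (N : S → ℕ), ∑ v, N v = K + 1 → N z ≠ 0 → ∃ x, hub x = z ∧ comp x = N) (hhub : ∀ x, comp x (hub x) ≠ 0) (hK : 1 ≤ K)
    (hW : ∀ v, 0 < W v) (hp0 : 0 ≤ p) (hp : ∀ v, p * W v ≤ 1) (hθ : ∀ v, θ v = 1 / (1 + p * W v)) (hacc : ∀ h v, acc h v = min 1 (W h / W v))
    (hμ0 : ∀ v, 0 ≤ μ0 v) (hμ1 : ∑ v, μ0 v = 1) (hσ0 : 0 ≤ σ) (hσ1 : σ < 1) (hρ0 : 0 ≤ ρ) (hρ : ρ ≤ 1 / 2)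
    (hKoff : ∀ N h v, h ≠ v → Kh N h v = if N h = 0 then 0 else (N v : ℝ) / K * acc h v) (hKdiag : ∀ N h, Kh N h h = 1 - ∑ v ∈ univ.erase h, Kh N h v)
    (hu : ∀ x v, u x v = (1 - σ) * (if v = hub x then (1 : ℝ) else 0) + σ * ∑ h, u x h * Kh (comp x) h v)
    (hut : ∀ x v, ut x v = ∑ h, u x h * Kh (comp x) h v)
    (hqtc : ∀ x y, IsCoupling (ut x) (ut y) (qt x y))
    (hq : ∀ x y a b, q x y a b = (1 - σ) * ((if a = hub x then (1 : ℝ) else 0) * (if b = hub y then (1 : ℝ) else 0)) + σ * qt x y a b)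
    (hΔ : ∀ N N', Δ N N' = ∑ v, (N v - N' v))
    (hmono : ∀ x y, hub x = hub y → ∀ a b, qt x y a b ≠ 0 → Δ (comp x - Pi.single a 1) (comp y - Pi.single b 1) ≤ Δ (comp x) (comp y))
    (hP : ∀ x x', P x x' = ∑ a, u x a * (μ0 (hub x') * (if comp x' + Pi.single a 1 = comp x + Pi.single (hub x') 1 then (1 : ℝ) else 0)))
    (hQ : ∀ x y x' y', Q (x, y) (x', y') = ∑ a, ∑ b, q x y a b * (μ0 (hub x')
      * (if comp x' + Pi.single a 1 = comp x + Pi.single (hub x') 1 then (1 : ℝ) else 0))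
      * ((if hub y' = hub x' then (1 : ℝ) else 0) * (if comp y' + Pi.single b 1 = comp y + Pi.single (hub y') 1 then (1 : ℝ) else 0)))
    (hF : ∀ x y, F (x, y) = (2 * (K : ℝ) + 2) + (-(1 - σ) * θ (hub x)) + (-(1 - σ) * θ (hub y)) + ∑ v, θ v * ((comp x v : ℝ) + (comp y v : ℝ)))
    (hC : C = 2 * ((K + 1) * ((2 * (K : ℝ) + 2) + 2 * K + 6)))
    (hΨ : ∀ x y, Ψ (x, y) = (Δ (comp x) (comp y) : ℝ) * F (x, y) + C * (if hub x = hub y then (0 : ℝ) else 1))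
    (hpers : ∀ x y, hub x = hub y →
      ρ * (Δ (comp x) (comp y) : ℝ) * F (x, y)
        ≤ σ * (((Δ (comp x) (comp y) : ℝ) - ∑ a, ∑ b, qt x y a b * (Δ (comp x - Pi.single a 1) (comp y - Pi.single b 1) : ℝ))
              * (F (x, y) + (2 * (1 - σ) * θ (hub x) + 2 * σ * ∑ v, μ0 v * θ v) - 2)
            + p * (Δ (comp x) (comp y) : ℝ) * (2 * ∑ v, μ0 v * (W v * θ v) - ∑ a, ut x a * (W a * θ a) - ∑ b, ut y b * (W b * θ b))))
    {π : X → ℝ} (hπ : IsStationary π P) (hπ0 : ∀ x, 0 ≤ π x) (hπ1 : ∑ x, π x = 1) (n : ℕ) :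
    worstTvDist P π n ≤ ((K + 1) * (4 * K + 4) + 2 * ((K + 1) * (4 * K + 8))) * (1 - ρ) ^ n := by
  have hK1 : (1 : ℝ) ≤ 2 * (K : ℝ) + 2 := by have : (0 : ℝ) ≤ K := Nat.cast_nonneg _; linarith
  have h := finiteOdds_lumped_worstTvDist_le (c := 2 * (K : ℝ) + 2) hinj hsum hsurj hhub hK hW hp0 hp hθ hacc hμ0 hμ1 hK1 hσ0 hσ1 hρ0 hρ hKoff hKdiag hu hut hqtc hq hΔ
    hmono hP hQ hF hC hΨ hpers hπ hπ0 hπ1 n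
  have e : ((K : ℝ) + 1) * ((2 * (K : ℝ) + 2) + 2 * K + 2) + 2 * ((K + 1) * ((2 * (K : ℝ) + 2) + 2 * K + 6)) = (K + 1) * (4 * K + 4) + 2 * ((K + 1) * (4 * K + 8)) := by ring
  rw [e] at h
  exact h

end FiniteOddsLumped


end Summit.Ventures.LatticeQCDFlow.Scaling
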